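import Literature.Analysis.OperatorTheory.NilpotentNumericalRadius
import Literature.MathematicalPhysics.QuantumLattice.InfVolFermionStateBounds
import HarnessLib

/-!
# A square-zero local observable has expectation at most half its norm in every state

Topic `Literature/MathematicalPhysics/QuantumLattice`; namespace
`Literature.MathematicalPhysics.QuantumLattice` (the file path). Companion of
`InfVolFermionStateBounds.lean` (`‖ω_Λ(A)‖ ≤ ‖A‖`). Everything is PROVED; no definition, no named fact.

**Result.** For an infinite-volume fermion state `ω` and a local observable `N ∈ 𝔄_Λ` with `N² = 0`,
`|ω_Λ(N)| ≤ ‖N‖ / 2` (L²-operator norm) — the `n = 2` case of the Haagerup–de la Harpe bound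
`w(T) ≤ ‖T‖ cos(π/(n+1))` for `Tⁿ = 0` (Proc. AMS 115 (1992) Thm. 1; P. Y. Wu, J. Operator Theory
38 (1997) Prop. 2.1), read through the state: `InfVolFermionState.norm_expect_le_half_norm_of_mul_self_eq_zero`,
with the contraction form `‖N‖ ≤ 1 ⇒ |ω_Λ(N)| ≤ ½` and the real-part form. The general statement
(any Hermitian functional dominated by the norm on any C⋆-algebra) is
`Literature.Analysis.OperatorTheory.norm_apply_le_half_of_mul_self_eq_zero`.

Typical use: a normal-ordered fermionic monomial `w = c†_{A} c_{B}` in which some mode occurs only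
daggered or only undaggered satisfies `w² = 0` (one anticommutation) and `‖w‖ ≤ 1`, so every state
has `|ω(w)| ≤ ½` — a certified a-priori box for such moments, sharper than `|ω(w)| ≤ ‖w‖ ≤ 1`.
-/

noncomputable section

namespace Literature.MathematicalPhysics.QuantumLattice

open Matrix HubbardWave0 Literature.Probability.LatticeModels

variable {d : ℕ}

namespace InfVolFermionState

variable (ω : InfVolFermionState d)

open scoped Matrix.Norms.L2Operator in
/-- **Square-zero observables are half-bounded in every state**: `N * N = 0` implies
`‖ω_Λ(N)‖ ≤ ‖N‖ / 2` (L²-operator norm). From the C⋆-form `‖N + Nᴴ‖ ≤ ‖N‖` of the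
Haagerup–de la Harpe inequality (`n = 2`) and `‖ω_Λ(A)‖ ≤ ‖A‖`, `ω_Λ(Aᴴ) = conj ω_Λ(A)`.
[cite: HaagerupDeLaHarpe1992, Theorem 1 (case n = 2)] [cite: Wu1997UnitaryDilations, Prop. 2.1] -/
theorem norm_expect_le_half_norm_of_mul_self_eq_zero (Λ : Finset (Site d)) {N : FermionOp Λ}
    (hN : N * N = 0) : ‖ω.expect Λ N‖ ≤ ‖N‖ / 2 := by
  have h := Literature.Analysis.OperatorTheory.norm_apply_le_half_of_mul_self_eq_zero
    (ω.expect Λ) zero_le_one (fun a => by simpa using ω.norm_expect_le Λ a)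
    (fun a => ω.expect_conjTranspose Λ a) hN
  simpa using h

open scoped Matrix.Norms.L2Operator in
/-- Contraction form: `N * N = 0`, `‖N‖ ≤ 1` ⇒ `‖ω_Λ(N)‖ ≤ 1/2`.
[cite: HaagerupDeLaHarpe1992, Theorem 1 (case n = 2)] -/
theorem norm_expect_le_half_of_mul_self_eq_zero (Λ : Finset (Site d)) {N : FermionOp Λ}
    (hN : N * N = 0) (hN1 : ‖N‖ ≤ 1) : ‖ω.expect Λ N‖ ≤ 1 / 2 :=
  (ω.norm_expect_le_half_norm_of_mul_self_eq_zero Λ hN).trans (by linarith)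

open scoped Matrix.Norms.L2Operator in
/-- Real-part form: `N * N = 0` ⇒ `|Re ω_Λ(N)| ≤ ‖N‖ / 2`.
[cite: HaagerupDeLaHarpe1992, Theorem 1 (case n = 2)] -/
theorem abs_re_expect_le_half_norm_of_mul_self_eq_zero (Λ : Finset (Site d)) {N : FermionOp Λ}
    (hN : N * N = 0) : |(ω.expect Λ N).re| ≤ ‖N‖ / 2 :=
  (Complex.abs_re_le_norm _).trans (ω.norm_expect_le_half_norm_of_mul_self_eq_zero Λ hN)

end InfVolFermionState

end Literature.MathematicalPhysics.QuantumLattice
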